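/-
Copyright (c) 2026 the pub-hodgecm-mathlib formalisation cell (harness21).  HEAD BYTES by prover seat hodgecm-mathlib-K2E3-p32 (g4) (F2 integrator, LEAD F0P6-plan (g16)
BATCH #269 (1) 2026-09-05T02:59:37Z); BODY pen hodgecm-mathlib-LH4-p09 (g11).  Track B «K2-LIT» ∕ hLiu418 = `stmt-HodgeConjecture-24832`: file F2b of the payer cut beneath
K2E3-p23 (g9)'s U1-glob TOP `K2LiuResidueVanishesOfPresentation` (#42F′ `slot_vanRes2E`).  THEOREMS ONLY (no `def`, no `instance`, no notation, no named-fact hypothesis);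
lane `--supports stmt-HodgeConjecture-24832 --as helper` (count-neutral).  Statements = K2E3-p32 (g4)'s HEAD BYTES (HOME `K2/K2E3-p32/g4/K2LiuTwistedSWPureTensorArchDatum.head.lean`) VERBATIM; bodies by LH4-p09 (g11); no `sorry`.
-/
import Summits.HodgeConjecture.HodgeConjecture.Theorems.K2LiuSiegelWeilTensorGenerator     -- ★ O42.3g (K2Liu-p08): `swSectionTensor_mul_right`, `isKFinite_swSectionTensor`, `continuous_swTensorTwisted`, `isSiegelDeltaSection_swTensorTwisted`
import Summits.HodgeConjecture.HodgeConjecture.Theorems.K2LiuTensorEmbArchFinParts         -- ★ U2f (K2Liu-p08): `finiteDimensional_span_orbit_of_mem_span_tmul_of_isStd`, `archPart_tensorEmb`, `finPart_tensorEmb`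
import Summits.HodgeConjecture.HodgeConjecture.Theorems.K2LiuSWSectionArchFinSplit         -- ★ F2a p864850 (K2E3-p32 g4): `exists_swSectionTensor_tmul_eq_mul`
import Summits.HodgeConjecture.HodgeConjecture.Theorems.K2LiuSiegelMiddleTermLevelLetters   -- ★ `rightTranslate_mem_rightTranslateSpan_of_mem` (right-`K`-stability of the span of translates)
import HarnessLib

/-!
# Crux `HLiu418`, U1-glob TOP (#42F′ `slot_vanRes2E`), payer file F2b: THE ARCHIMEDEAN KERNEL DATUM `(aφ, b)` OF A PURE SECTION —
# ★ END `resGen_eq_zero_of_localKernel_arch`'s (3a) letters `hφ hb hbfin hbc` (+ `(y₀, hy₀)` and the FORMULA for `b`) for any fin–arch decomposable, `K`-finite,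
# continuous Siegel section `φ` with a base point `φ h₀ ≠ 0`; instantiated at the twisted Siegel–Weil section of a pure tensor `E(a ⊗ f)`, `a ∈ V`

Cell `hodgecm-mathlib`, crux item hLiu418 = `stmt-HodgeConjecture-24832`; squad K2, strike line L1, LEAD F0P6-plan (g16); TOP pen K2E3-p23 (g9); F2 integrator K2E3-p32 (g4)
(F2a ★-cand p864850 `K2LiuSWSectionArchFinSplit`); F2b body LH4-p09 (g11); U1 desk K2E3-p28 (g4); typist K2E3-typ3 (g3).

THE POINT.  ★ END's archimedean kernel datum (binders (3a) `{aφ b} hb hbfin hbc hφ` and (5) `y₀ hy₀`, n := 2) asks for the origin section `φ` of a summand to be PURE: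
`φ(h) = aφ(h_f) · b(h_∞)` with `b` continuous, `K_∞`-finite w.r.t. `𝒦.K` and carrying the archimedean Siegel law of `I(sφ, χ)`, and a point with `b y₀ ≠ 0`.  §1 produces ALL of it
from four generic properties of `φ : H(𝔸) → ℂ` — (dec) SOME fin–arch factorisation `φ = P(h_f)·Q(h_∞)` exists, (sec) `φ ∈ I(s₀, χ)` is a Siegel section, (Kf) `φ` is `K`-finite for
`𝒦` (★ `IsKFinite`), (cont) `φ` continuous — and a base point `φ h₀ ≠ 0`, with the EXPLICIT witnesses `b x := φ((1, h₀,f) · (x, 1))`, `aφ u := φ((1, u) · (h₀,∞, 1)) ∕ φ h₀`: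
`hφ` by (dec) (`φ(u·x)·φ(h₀) = φ(u·h₀,∞)·φ(h₀,f·x)`), `hb` by (sec) + ★ `commute_archToAdelic_finAdelicToAdelic` (a purely archimedean `p ∈ P_Δ(𝔸)` commutes past `(1, h₀,f)`),
`hbfin` with `V_b :=` the image of ★ `rightTranslateSpan 𝒦 φ` (finite-dimensional by (Kf), stable under right `K`-translation) under `G ↦ (x ↦ G((1,h₀,f)·(x,1)))`, `hbc` by (cont) +
★ `continuous_archToAdelic`, `y₀ := h₀,∞`.  §2 instantiates at `φ := α(det h) · f^{V′}_{E(a ⊗ f)}(h)` — the origin section of the TOP's summand at a pure-tensor generator of the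
rigidity domain `D_V` (`a ∈ V`, `V` finite-dimensional and stable under the purely archimedean elements of `𝒦.K`, the slot's `hKV`): (dec) = F2a ★-cand `exists_swSectionTensor_tmul_eq_mul`
× `α(det((h_∞,1)(1,h_f))) = α(det(h_∞,1))·α(det(1,h_f))`; (sec)(Kf)(cont) = ★ O42.3g at `s := s₀` (`stdExtension_self`), `K`-finiteness of `E(a ⊗ f)` by ★ U2f
`finiteDimensional_span_orbit_of_mem_span_tmul_of_isStd`.
* §1 **`exists_archDatum_of_pure`** — generic.
* §2 **`exists_archDatum_of_pureTensor`** — at the twisted Siegel–Weil section of `E(a ⊗ f)`, character `χ_b^{M₂}·α̃ = χ` (hypothesis `hχ`, = the slot's `hχD` at `M₂ = 3`),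
  `s₀ = (M₂ − n)/2`.
References: [KudlaRallis1994] §1; [HarrisKudlaSweet1996] §1 (1.15)–(1.17); [BorelJacquet1979] §4.1 (factorizable vectors, `g = g_∞ g_f`); [Tan1999] §1; [Weil1964] Chap. III n° 38–40.
HONEST LABEL.  Count-neutral helper: `HC_CM` is proved only modulo the 7 printed citations (2 remaining named inputs: hLiu418 = `stmt-HodgeConjecture-24832`,
h413 = `stmt-HodgeConjecture-24833`) until rung 0 closes; U1-glob stays OPEN — this file is one payer brick beneath its TOP.
-/

set_option autoImplicit false
set_option linter.dupNamespace false -- the mandated namespace repeats `HodgeConjecture.HodgeConjecture`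

noncomputable section

open scoped Matrix TensorProduct SchwartzMap Classical
open NumberField NumberField.mixedEmbedding IsDedekindDomain
open Literature.NumberTheory.Automorphic Literature.NumberTheory.Automorphic.UnitaryGroup Literature.NumberTheory.GaloisRepresentations
open Literature.NumberTheory.GelbartRogawski1991 Literature.NumberTheory.GelbartRogawski1991.GRConstruction
open Literature.NumberTheory.GelbartRogawski1991.UnitaryDualPair
open Literature.NumberTheory.Weil1964 Literature.RepresentationTheory.HarrisKudlaSweet1996
open Literature.NumberTheory.K2Lit.SiegelDoubled

namespace Summit.HodgeConjecture.HodgeConjecture.Cruxes.HLiu418.K2LiuTwistedSWPureTensorArchDatum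

open Summit.HodgeConjecture.HodgeConjecture.Cruxes.HLiu418.K2LiuSiegelWeilTensorGenerator (isStandardSectionFamily_swTensorTwisted continuous_swTensorTwisted)
open Summit.HodgeConjecture.HodgeConjecture.Cruxes.HLiu418.K2LiuTensorEmbArchFinParts (finiteDimensional_span_orbit_of_mem_span_tmul_of_isStd)
open Summit.HodgeConjecture.HodgeConjecture.Cruxes.HLiu418.K2LiuSWSectionArchFinSplit (exists_swSectionTensor_tmul_eq_mul)
open Summit.HodgeConjecture.HodgeConjecture.Cruxes.HLiu418.K2LiuSiegelMiddleTermLevelLetters (rightTranslate_mem_rightTranslateSpan_of_mem)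

variable (L : Type) [Field L] [NumberField L] [IsCMField L]
variable {N M n : ℕ} (e : Fin N × Fin M ≃ Fin n)
  (dV : Fin N → L) (hdV : ∀ i, IsCMField.complexConj L (dV i) = dV i)
  (dW : Fin M → L) (hdW : ∀ i, IsCMField.complexConj L (dW i) = dW i)

/-! ## §1 The archimedean kernel datum of a pure, `K`-finite, continuous Siegel section with a base point -/

/-- **THE ARCHIMEDEAN KERNEL DATUM OF A PURE SECTION.**  `𝒦` an Iwasawa datum, `φ ∈ I(s₀, χ)` a Siegel section on `H(𝔸)` that is `K`-finite for `𝒦`, continuous, fin–arch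
DECOMPOSABLE (`φ = P(h_f)·Q(h_∞)` for SOME `P`, `Q`) and non-zero at `h₀`.  Then with `b x := φ((1,h₀,f)·(x,1))` and `aφ u := φ((1,u)·(h₀,∞,1)) ∕ φ h₀`: (hφ) `φ(h) = aφ(h_f)·b(h_∞)`;
(hb) `b` carries the archimedean Siegel law of `I(s₀, χ)`; (hbfin) `b` lies in a finite-dimensional space of functions on `H(L⁺ ⊗ ℝ)` stable under right translation by every
`a₀` with `(a₀, 1) ∈ 𝒦.K`; (hbc) `b` is continuous; `b(h₀,∞) ≠ 0`; and the formula for `b` — ★ END `resGen_eq_zero_of_localKernel_arch`'s binders (3a)+(5) at `n := 2`.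
[cite: BorelJacquet1979, §4.1] [cite: KudlaRallis1994, §1] [cite: HarrisKudlaSweet1996, §1 (1.15)–(1.17)] [cite: Tan1999, §1] -/
theorem exists_archDatum_of_pure (𝒦 : IwasawaDatum L e dV hdV dW hdW) (χ : HeckeCharacter L) (s₀ : ℂ) {φ : HA L e dV hdV dW hdW → ℂ}
    (hdec : ∃ (P : UnitaryGroup.finAdelic (Fp L) L (IsCMField.complexConj L) (n + n) (hermD L e dV hdV dW hdW) → ℂ)
        (Q : UnitaryGroup.arch (Fp L) L (IsCMField.complexConj L) (n + n) (hermD L e dV hdV dW hdW) → ℂ),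
        ∀ h : HA L e dV hdV dW hdW, φ h = P (UnitaryGroup.finPart (Fp L) L (IsCMField.complexConj L) (n + n) (hermD L e dV hdV dW hdW) h) *
          Q (UnitaryGroup.archPart (Fp L) L (IsCMField.complexConj L) (n + n) (hermD L e dV hdV dW hdW) h))
    (hsec : IsSiegelDeltaSection L e dV hdV dW hdW χ s₀ φ) (hKf : IsKFinite 𝒦 φ) (hcont : Continuous φ)
    (h₀ : HA L e dV hdV dW hdW) (hφ₀ : φ h₀ ≠ 0) :
    ∃ (aφ : UnitaryGroup.finAdelic (Fp L) L (IsCMField.complexConj L) (n + n) (hermD L e dV hdV dW hdW) → ℂ)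
      (b : UnitaryGroup.arch (Fp L) L (IsCMField.complexConj L) (n + n) (hermD L e dV hdV dW hdW) → ℂ),
      -- (hφ) purity
      (∀ h : HA L e dV hdV dW hdW, φ h = aφ (UnitaryGroup.finPart (Fp L) L (IsCMField.complexConj L) (n + n) (hermD L e dV hdV dW hdW) h) *
        b (UnitaryGroup.archPart (Fp L) L (IsCMField.complexConj L) (n + n) (hermD L e dV hdV dW hdW) h)) ∧
      -- (hb) the archimedean Siegel law at `s₀`
      (∀ p : HA L e dV hdV dW hdW, GRConstruction.IsSiegelDelta L e dV hdV dW hdW p →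
        UnitaryGroup.finPart (Fp L) L (IsCMField.complexConj L) (n + n) (hermD L e dV hdV dW hdW) p = 1 →
        ∀ x : UnitaryGroup.arch (Fp L) L (IsCMField.complexConj L) (n + n) (hermD L e dV hdV dW hdW),
          b (UnitaryGroup.archPart (Fp L) L (IsCMField.complexConj L) (n + n) (hermD L e dV hdV dW hdW) p * x) = siegelDeltaCharacter L e dV hdV dW hdW χ s₀ p * b x) ∧
      -- (hbfin) `K_∞`-finiteness w.r.t. `𝒦.K`
      (∃ V : Submodule ℂ (UnitaryGroup.arch (Fp L) L (IsCMField.complexConj L) (n + n) (hermD L e dV hdV dW hdW) → ℂ), FiniteDimensional ℂ V ∧ b ∈ V ∧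
        ∀ a₀ : UnitaryGroup.arch (Fp L) L (IsCMField.complexConj L) (n + n) (hermD L e dV hdV dW hdW),
          (UnitaryGroup.archToAdelic (Fp L) L (IsCMField.complexConj L) (n + n) (hermD L e dV hdV dW hdW) a₀ : HA L e dV hdV dW hdW) ∈ 𝒦.K →
          ∀ G ∈ V, (fun x => G (x * a₀)) ∈ V) ∧
      -- (hbc) continuity
      Continuous b ∧
      -- (hy₀) the base point
      b (UnitaryGroup.archPart (Fp L) L (IsCMField.complexConj L) (n + n) (hermD L e dV hdV dW hdW) h₀) ≠ 0 ∧
      -- the formula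
      (∀ x : UnitaryGroup.arch (Fp L) L (IsCMField.complexConj L) (n + n) (hermD L e dV hdV dW hdW),
        b x = φ (UnitaryGroup.finAdelicToAdelic (Fp L) L (IsCMField.complexConj L) (n + n) (hermD L e dV hdV dW hdW)
          (UnitaryGroup.finPart (Fp L) L (IsCMField.complexConj L) (n + n) (hermD L e dV hdV dW hdW) h₀) *
          UnitaryGroup.archToAdelic (Fp L) L (IsCMField.complexConj L) (n + n) (hermD L e dV hdV dW hdW) x)) := by
  classical
  obtain ⟨P, Q, hPQ⟩ := hdec
  -- the archimedean ∕ finite parts of `(1,u)·(x,1)`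
  have hπa : ∀ (u : UnitaryGroup.finAdelic (Fp L) L (IsCMField.complexConj L) (n + n) (hermD L e dV hdV dW hdW)) (x : UnitaryGroup.arch (Fp L) L (IsCMField.complexConj L) (n + n) (hermD L e dV hdV dW hdW)), UnitaryGroup.archPart (Fp L) L (IsCMField.complexConj L) (n + n) (hermD L e dV hdV dW hdW) (UnitaryGroup.finAdelicToAdelic (Fp L) L (IsCMField.complexConj L) (n + n) (hermD L e dV hdV dW hdW) u * UnitaryGroup.archToAdelic (Fp L) L (IsCMField.complexConj L) (n + n) (hermD L e dV hdV dW hdW) x) = x := fun u x => by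
    rw [map_mul, UnitaryGroup.archPart_finAdelicToAdelic, UnitaryGroup.archPart_archToAdelic, one_mul]
  have hπf : ∀ (u : UnitaryGroup.finAdelic (Fp L) L (IsCMField.complexConj L) (n + n) (hermD L e dV hdV dW hdW)) (x : UnitaryGroup.arch (Fp L) L (IsCMField.complexConj L) (n + n) (hermD L e dV hdV dW hdW)), UnitaryGroup.finPart (Fp L) L (IsCMField.complexConj L) (n + n) (hermD L e dV hdV dW hdW) (UnitaryGroup.finAdelicToAdelic (Fp L) L (IsCMField.complexConj L) (n + n) (hermD L e dV hdV dW hdW) u * UnitaryGroup.archToAdelic (Fp L) L (IsCMField.complexConj L) (n + n) (hermD L e dV hdV dW hdW) x) = u := fun u x => by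
    rw [map_mul, UnitaryGroup.finPart_finAdelicToAdelic, UnitaryGroup.finPart_archToAdelic, mul_one]
  have hmix : ∀ (u : UnitaryGroup.finAdelic (Fp L) L (IsCMField.complexConj L) (n + n) (hermD L e dV hdV dW hdW)) (x : UnitaryGroup.arch (Fp L) L (IsCMField.complexConj L) (n + n) (hermD L e dV hdV dW hdW)), φ (UnitaryGroup.finAdelicToAdelic (Fp L) L (IsCMField.complexConj L) (n + n) (hermD L e dV hdV dW hdW) u * UnitaryGroup.archToAdelic (Fp L) L (IsCMField.complexConj L) (n + n) (hermD L e dV hdV dW hdW) x) = P u * Q x := fun u x => by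
    rw [hPQ, hπf, hπa]
  have hφ₀' : φ h₀ = P (UnitaryGroup.finPart (Fp L) L (IsCMField.complexConj L) (n + n) (hermD L e dV hdV dW hdW) h₀) * Q (UnitaryGroup.archPart (Fp L) L (IsCMField.complexConj L) (n + n) (hermD L e dV hdV dW hdW) h₀) := hPQ h₀
  have hP₀ : P (UnitaryGroup.finPart (Fp L) L (IsCMField.complexConj L) (n + n) (hermD L e dV hdV dW hdW) h₀) ≠ 0 := fun h0 => hφ₀ (by rw [hφ₀', h0, zero_mul])
  have hQ₀ : Q (UnitaryGroup.archPart (Fp L) L (IsCMField.complexConj L) (n + n) (hermD L e dV hdV dW hdW) h₀) ≠ 0 := fun h0 => hφ₀ (by rw [hφ₀', h0, mul_zero])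
  refine ⟨fun u => φ (UnitaryGroup.finAdelicToAdelic (Fp L) L (IsCMField.complexConj L) (n + n) (hermD L e dV hdV dW hdW) u * UnitaryGroup.archToAdelic (Fp L) L (IsCMField.complexConj L) (n + n) (hermD L e dV hdV dW hdW) (UnitaryGroup.archPart (Fp L) L (IsCMField.complexConj L) (n + n) (hermD L e dV hdV dW hdW) h₀)) / φ h₀, fun x => φ (UnitaryGroup.finAdelicToAdelic (Fp L) L (IsCMField.complexConj L) (n + n) (hermD L e dV hdV dW hdW) (UnitaryGroup.finPart (Fp L) L (IsCMField.complexConj L) (n + n) (hermD L e dV hdV dW hdW) h₀) * UnitaryGroup.archToAdelic (Fp L) L (IsCMField.complexConj L) (n + n) (hermD L e dV hdV dW hdW) x), ?_, ?_, ?_, ?_, ?_, fun x => rfl⟩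
  · -- (hφ) purity: `φ(u·x)·φ(h₀) = φ(u·h₀,∞)·φ(h₀,f·x)`
    intro h
    show φ h = φ (UnitaryGroup.finAdelicToAdelic (Fp L) L (IsCMField.complexConj L) (n + n) (hermD L e dV hdV dW hdW) (UnitaryGroup.finPart (Fp L) L (IsCMField.complexConj L) (n + n) (hermD L e dV hdV dW hdW) h) * UnitaryGroup.archToAdelic (Fp L) L (IsCMField.complexConj L) (n + n) (hermD L e dV hdV dW hdW) (UnitaryGroup.archPart (Fp L) L (IsCMField.complexConj L) (n + n) (hermD L e dV hdV dW hdW) h₀)) / φ h₀ * φ (UnitaryGroup.finAdelicToAdelic (Fp L) L (IsCMField.complexConj L) (n + n) (hermD L e dV hdV dW hdW) (UnitaryGroup.finPart (Fp L) L (IsCMField.complexConj L) (n + n) (hermD L e dV hdV dW hdW) h₀) * UnitaryGroup.archToAdelic (Fp L) L (IsCMField.complexConj L) (n + n) (hermD L e dV hdV dW hdW) (UnitaryGroup.archPart (Fp L) L (IsCMField.complexConj L) (n + n) (hermD L e dV hdV dW hdW) h))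
    rw [hmix, hmix, hPQ h, hφ₀']
    field_simp
  · -- (hb) the archimedean Siegel law: a purely archimedean `p ∈ P_Δ(𝔸)` commutes past `(1, h₀,f)`
    intro p hp hp1 x
    have hpa : UnitaryGroup.archToAdelic (Fp L) L (IsCMField.complexConj L) (n + n) (hermD L e dV hdV dW hdW) (UnitaryGroup.archPart (Fp L) L (IsCMField.complexConj L) (n + n) (hermD L e dV hdV dW hdW) p) = p := by
      have h := UnitaryGroup.archToAdelic_mul_finAdelicToAdelic (Fp L) L (IsCMField.complexConj L) (n + n) (hermD L e dV hdV dW hdW) p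
      rwa [hp1, map_one, mul_one] at h
    have hcomm : UnitaryGroup.finAdelicToAdelic (Fp L) L (IsCMField.complexConj L) (n + n) (hermD L e dV hdV dW hdW) (UnitaryGroup.finPart (Fp L) L (IsCMField.complexConj L) (n + n) (hermD L e dV hdV dW hdW) h₀) * UnitaryGroup.archToAdelic (Fp L) L (IsCMField.complexConj L) (n + n) (hermD L e dV hdV dW hdW) (UnitaryGroup.archPart (Fp L) L (IsCMField.complexConj L) (n + n) (hermD L e dV hdV dW hdW) p) = UnitaryGroup.archToAdelic (Fp L) L (IsCMField.complexConj L) (n + n) (hermD L e dV hdV dW hdW) (UnitaryGroup.archPart (Fp L) L (IsCMField.complexConj L) (n + n) (hermD L e dV hdV dW hdW) p) * UnitaryGroup.finAdelicToAdelic (Fp L) L (IsCMField.complexConj L) (n + n) (hermD L e dV hdV dW hdW) (UnitaryGroup.finPart (Fp L) L (IsCMField.complexConj L) (n + n) (hermD L e dV hdV dW hdW) h₀) :=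
      (UnitaryGroup.commute_archToAdelic_finAdelicToAdelic (Fp L) L (IsCMField.complexConj L) (n + n) (hermD L e dV hdV dW hdW) _ _).eq.symm
    show φ (UnitaryGroup.finAdelicToAdelic (Fp L) L (IsCMField.complexConj L) (n + n) (hermD L e dV hdV dW hdW) (UnitaryGroup.finPart (Fp L) L (IsCMField.complexConj L) (n + n) (hermD L e dV hdV dW hdW) h₀) * UnitaryGroup.archToAdelic (Fp L) L (IsCMField.complexConj L) (n + n) (hermD L e dV hdV dW hdW) (UnitaryGroup.archPart (Fp L) L (IsCMField.complexConj L) (n + n) (hermD L e dV hdV dW hdW) p * x)) = siegelDeltaCharacter L e dV hdV dW hdW χ s₀ p * φ (UnitaryGroup.finAdelicToAdelic (Fp L) L (IsCMField.complexConj L) (n + n) (hermD L e dV hdV dW hdW) (UnitaryGroup.finPart (Fp L) L (IsCMField.complexConj L) (n + n) (hermD L e dV hdV dW hdW) h₀) * UnitaryGroup.archToAdelic (Fp L) L (IsCMField.complexConj L) (n + n) (hermD L e dV hdV dW hdW) x)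
    rw [map_mul (UnitaryGroup.archToAdelic (Fp L) L (IsCMField.complexConj L) (n + n) (hermD L e dV hdV dW hdW)), ← mul_assoc, hcomm, hpa, mul_assoc]
    exact hsec p hp _
  · -- (hbfin) `V_b :=` the image of the span of the right `K`-translates of `φ` under `G ↦ (x ↦ G((1,h₀,f)·(x,1)))`
    haveI : FiniteDimensional ℂ (rightTranslateSpan 𝒦 φ) := hKf
    let T : (HA L e dV hdV dW hdW → ℂ) →ₗ[ℂ] (UnitaryGroup.arch (Fp L) L (IsCMField.complexConj L) (n + n) (hermD L e dV hdV dW hdW) → ℂ) :=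
      { toFun := fun G x => G (UnitaryGroup.finAdelicToAdelic (Fp L) L (IsCMField.complexConj L) (n + n) (hermD L e dV hdV dW hdW) (UnitaryGroup.finPart (Fp L) L (IsCMField.complexConj L) (n + n) (hermD L e dV hdV dW hdW) h₀) * UnitaryGroup.archToAdelic (Fp L) L (IsCMField.complexConj L) (n + n) (hermD L e dV hdV dW hdW) x)
        map_add' := fun _ _ => rfl
        map_smul' := fun _ _ => rfl }
    refine ⟨(rightTranslateSpan 𝒦 φ).map T, inferInstance, ⟨φ, self_mem_rightTranslateSpan 𝒦 φ, rfl⟩, ?_⟩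
    intro a₀ ha₀ G hG
    obtain ⟨G', hG', rfl⟩ := hG
    refine ⟨_, rightTranslate_mem_rightTranslateSpan_of_mem 𝒦 φ hG' ha₀, ?_⟩
    funext x
    change G' (UnitaryGroup.finAdelicToAdelic (Fp L) L (IsCMField.complexConj L) (n + n) (hermD L e dV hdV dW hdW) (UnitaryGroup.finPart (Fp L) L (IsCMField.complexConj L) (n + n) (hermD L e dV hdV dW hdW) h₀) * UnitaryGroup.archToAdelic (Fp L) L (IsCMField.complexConj L) (n + n) (hermD L e dV hdV dW hdW) x * UnitaryGroup.archToAdelic (Fp L) L (IsCMField.complexConj L) (n + n) (hermD L e dV hdV dW hdW) a₀) = G' (UnitaryGroup.finAdelicToAdelic (Fp L) L (IsCMField.complexConj L) (n + n) (hermD L e dV hdV dW hdW) (UnitaryGroup.finPart (Fp L) L (IsCMField.complexConj L) (n + n) (hermD L e dV hdV dW hdW) h₀) * UnitaryGroup.archToAdelic (Fp L) L (IsCMField.complexConj L) (n + n) (hermD L e dV hdV dW hdW) (x * a₀))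
    rw [map_mul (UnitaryGroup.archToAdelic (Fp L) L (IsCMField.complexConj L) (n + n) (hermD L e dV hdV dW hdW)), mul_assoc]
  · -- (hbc) continuity
    exact hcont.comp (continuous_const.mul (UnitaryGroup.continuous_archToAdelic (Fp L) L (IsCMField.complexConj L) (n + n) (hermD L e dV hdV dW hdW)))
  · -- (hy₀) the base point `y₀ := h₀,∞`
    show φ (UnitaryGroup.finAdelicToAdelic (Fp L) L (IsCMField.complexConj L) (n + n) (hermD L e dV hdV dW hdW) (UnitaryGroup.finPart (Fp L) L (IsCMField.complexConj L) (n + n) (hermD L e dV hdV dW hdW) h₀) * UnitaryGroup.archToAdelic (Fp L) L (IsCMField.complexConj L) (n + n) (hermD L e dV hdV dW hdW) (UnitaryGroup.archPart (Fp L) L (IsCMField.complexConj L) (n + n) (hermD L e dV hdV dW hdW) h₀)) ≠ 0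
    rw [hmix, ← hφ₀']
    exact hφ₀

/-! ## §2 At the twisted Siegel–Weil section of a pure-tensor generator `E(a ⊗ f)`, `a ∈ V` -/

variable (hdV0 : ∀ i, dV i ≠ 0) (hdW0 : ∀ i, dW i ≠ 0)
variable {M₂ M' n' : ℕ} (eW : Fin M × Fin M₂ ≃ Fin M') (e' : Fin N × Fin M' ≃ Fin n')
  (dV' : Fin M₂ → L) (hdV' : ∀ k, IsCMField.complexConj L (dV' k) = dV' k) (hdV'0 : ∀ k, dV' k ≠ 0)

/-- **THE ARCHIMEDEAN KERNEL DATUM OF THE TWISTED SIEGEL–WEIL SECTION OF A PURE TENSOR.**  For the K2Lit tensor datum (`s^B` a `χ_b`-normalised doubled Weil representation of the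
big datum, `M₂ ≠ 0`), a STANDARD small Iwasawa datum `𝒦`, a finite-dimensional `V ⊂ 𝓢((L⁺ ⊗ ℝ)^{n′+n′})` stable slot-wise under the purely archimedean elements of `𝒦.K` (the slot's
`hKV`), a continuous automorphic `α` with `χ_b^{M₂}·α̃ = χ`, a generator `E(a ⊗ f)` with `a ∈ V`, and a base point `h₀` where `φ := α(det ·)·f^{V′}_{E(a ⊗ f)}` is non-zero: the six
clauses of §1 for `φ` at `s₀ = (M₂ − n)/2` — ★ END's (3a)+(5) letters for the summand `stdExtension 𝒦 s₀ φ` of the TOP's presentation. (dec) = F2a `exists_swSectionTensor_tmul_eq_mul` ×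
multiplicativity of `α ∘ det`; (sec)(Kf)(cont) = ★ O42.3g at `s := s₀`; `K`-finiteness of `E(a ⊗ f)` = ★ U2f. [cite: KudlaRallis1994, §1] [cite: HarrisKudlaSweet1996, §1 (1.15)–(1.17)]
[cite: BorelJacquet1979, §4.1] [cite: Weil1964, Chap. III n° 38–40 pp. 190–191] -/
theorem exists_archDatum_of_pureTensor (hM₂ : M₂ ≠ 0) {χb χ : HeckeCharacter L} (hχbu : χb.IsUnitary) (hχbs : IsSplittingChar L 1 χb)
    {sB : HA L e' dV hdV (tensorFrame L dW eW dV') (tensorFrame_real L dW hdW eW dV' hdV') →*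
      MpD L e' dV hdV (tensorFrame L dW eW dV') (tensorFrame_real L dW hdW eW dV' hdV')}
    (hsB : IsDoubledWeilRep L e' dV hdV hdV0 (tensorFrame L dW eW dV') (tensorFrame_real L dW hdW eW dV' hdV')
      (tensorFrame_ne_zero L dW eW dV' hdW0 hdV'0) χb sB)
    {𝒦 : IwasawaDatum L e dV hdV dW hdW} (h𝒦 : 𝒦.IsStd)
    (V : Submodule ℂ 𝓢(((Fin (n' + n')) → mixedSpace (Fp L)), ℂ)) [FiniteDimensional ℂ V]
    (hKV : ∀ ainf : UnitaryGroup.arch (Fp L) L (IsCMField.complexConj L) (n + n) (hermD L e dV hdV dW hdW),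
      (UnitaryGroup.archToAdelic (Fp L) L (IsCMField.complexConj L) (n + n) (hermD L e dV hdV dW hdW) ainf : HA L e dV hdV dW hdW) ∈ 𝒦.K →
      ∀ a ∈ V, ∃ a'' ∈ V, ∀ f : FinSB (Fp L) (Fin (n' + n')),
        adelicMpCont.omega (Fp L) (Fin (n' + n')) (gramDA L e' dV hdV (tensorFrame L dW eW dV') (tensorFrame_real L dW hdW eW dV' hdV'))
            (sB (tensorEmb L e dV hdV dW hdW eW e' dV' hdV'
              (UnitaryGroup.archToAdelic (Fp L) L (IsCMField.complexConj L) (n + n) (hermD L e dV hdV dW hdW) ainf)))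
            (piSchwartzBruhatEquiv (Fp L) (Fin (n' + n')) (a ⊗ₜ[ℂ] f)) =
          piSchwartzBruhatEquiv (Fp L) (Fin (n' + n')) (a'' ⊗ₜ[ℂ] f))
    (α : UnitaryGroup.adelicOne (Fp L) L (IsCMField.complexConj L) →* ℂˣ) (hα : Continuous α)
    (hαrat : ∀ u : UnitaryGroup.adelicOne (Fp L) L (IsCMField.complexConj L), (u : ideleGroup L) ∈ principalIdeles L → α u = 1)
    (hχ : χb ^ M₂ * DoubledWeilDetTwist.ratioHecke L α hα hαrat = χ)
    {a : 𝓢(((Fin (n' + n')) → mixedSpace (Fp L)), ℂ)} (ha : a ∈ V) (f : FinSB (Fp L) (Fin (n' + n')))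
    (h₀ : HA L e dV hdV dW hdW)
    (hφ₀ : ((DoubledWeilDetTwist.detChar L e dV hdV hdV0 dW hdW hdW0 α h₀ : ℂˣ) : ℂ) *
      swSectionTensor L e dV hdV dW hdW eW e' dV' hdV' hdV0 hdW0 hdV'0 sB (piSchwartzBruhatEquiv (Fp L) (Fin (n' + n')) (a ⊗ₜ[ℂ] f)) h₀ ≠ 0) :
    ∃ (aφ : UnitaryGroup.finAdelic (Fp L) L (IsCMField.complexConj L) (n + n) (hermD L e dV hdV dW hdW) → ℂ)
      (b : UnitaryGroup.arch (Fp L) L (IsCMField.complexConj L) (n + n) (hermD L e dV hdV dW hdW) → ℂ),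
      -- (hφ) purity of the origin section `φ = α(det ·) · f^{V′}_{E(a ⊗ f)}`
      (∀ h : HA L e dV hdV dW hdW,
        ((DoubledWeilDetTwist.detChar L e dV hdV hdV0 dW hdW hdW0 α h : ℂˣ) : ℂ) *
            swSectionTensor L e dV hdV dW hdW eW e' dV' hdV' hdV0 hdW0 hdV'0 sB (piSchwartzBruhatEquiv (Fp L) (Fin (n' + n')) (a ⊗ₜ[ℂ] f)) h =
          aφ (UnitaryGroup.finPart (Fp L) L (IsCMField.complexConj L) (n + n) (hermD L e dV hdV dW hdW) h) *
            b (UnitaryGroup.archPart (Fp L) L (IsCMField.complexConj L) (n + n) (hermD L e dV hdV dW hdW) h)) ∧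
      -- (hb) the archimedean Siegel law at `s₀ = (M₂ − n)/2` for `χ = χ_b^{M₂}·α̃`
      (∀ p : HA L e dV hdV dW hdW, GRConstruction.IsSiegelDelta L e dV hdV dW hdW p →
        UnitaryGroup.finPart (Fp L) L (IsCMField.complexConj L) (n + n) (hermD L e dV hdV dW hdW) p = 1 →
        ∀ x : UnitaryGroup.arch (Fp L) L (IsCMField.complexConj L) (n + n) (hermD L e dV hdV dW hdW),
          b (UnitaryGroup.archPart (Fp L) L (IsCMField.complexConj L) (n + n) (hermD L e dV hdV dW hdW) p * x) =
            siegelDeltaCharacter L e dV hdV dW hdW χ (((M₂ : ℂ) - (n : ℂ)) / 2) p * b x) ∧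
      -- (hbfin) `K_∞`-finiteness w.r.t. `𝒦.K`
      (∃ V : Submodule ℂ (UnitaryGroup.arch (Fp L) L (IsCMField.complexConj L) (n + n) (hermD L e dV hdV dW hdW) → ℂ), FiniteDimensional ℂ V ∧ b ∈ V ∧
        ∀ a₀ : UnitaryGroup.arch (Fp L) L (IsCMField.complexConj L) (n + n) (hermD L e dV hdV dW hdW),
          (UnitaryGroup.archToAdelic (Fp L) L (IsCMField.complexConj L) (n + n) (hermD L e dV hdV dW hdW) a₀ : HA L e dV hdV dW hdW) ∈ 𝒦.K →
          ∀ G ∈ V, (fun x => G (x * a₀)) ∈ V) ∧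
      -- (hbc) continuity
      Continuous b ∧
      -- (hy₀) the base point `y₀ := h₀,∞`
      b (UnitaryGroup.archPart (Fp L) L (IsCMField.complexConj L) (n + n) (hermD L e dV hdV dW hdW) h₀) ≠ 0 ∧
      -- the formula for `b`
      (∀ x : UnitaryGroup.arch (Fp L) L (IsCMField.complexConj L) (n + n) (hermD L e dV hdV dW hdW),
        b x = ((DoubledWeilDetTwist.detChar L e dV hdV hdV0 dW hdW hdW0 α
              (UnitaryGroup.finAdelicToAdelic (Fp L) L (IsCMField.complexConj L) (n + n) (hermD L e dV hdV dW hdW)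
                  (UnitaryGroup.finPart (Fp L) L (IsCMField.complexConj L) (n + n) (hermD L e dV hdV dW hdW) h₀) *
                UnitaryGroup.archToAdelic (Fp L) L (IsCMField.complexConj L) (n + n) (hermD L e dV hdV dW hdW) x) : ℂˣ) : ℂ) *
          swSectionTensor L e dV hdV dW hdW eW e' dV' hdV' hdV0 hdW0 hdV'0 sB (piSchwartzBruhatEquiv (Fp L) (Fin (n' + n')) (a ⊗ₜ[ℂ] f))
            (UnitaryGroup.finAdelicToAdelic (Fp L) L (IsCMField.complexConj L) (n + n) (hermD L e dV hdV dW hdW)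
                (UnitaryGroup.finPart (Fp L) L (IsCMField.complexConj L) (n + n) (hermD L e dV hdV dW hdW) h₀) *
              UnitaryGroup.archToAdelic (Fp L) L (IsCMField.complexConj L) (n + n) (hermD L e dV hdV dW hdW) x)) := by
  -- `K`-finiteness of the generator `E(a ⊗ f)` for the SMALL datum (★ U2f, from the slot's `hKV`)
  have hΦ := finiteDimensional_span_orbit_of_mem_span_tmul_of_isStd L e dV hdV dW hdW eW e' dV' hdV' hdV0 hdW0 hdV'0 h𝒦 hsB V hKV
    (Φ := piSchwartzBruhatEquiv (Fp L) (Fin (n' + n')) (a ⊗ₜ[ℂ] f)) (Submodule.subset_span ⟨a, ha, f, rfl⟩)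
  -- the package ★ O42.3g at `s := s₀` (`stdExtension_self`)
  have hstd := isStandardSectionFamily_swTensorTwisted L e dV hdV hdV0 dW hdW hdW0 eW e' dV' hdV' hdV'0 α hM₂ hsB 𝒦 _ hΦ hα hαrat
  have hsec : IsSiegelDeltaSection L e dV hdV dW hdW χ (((M₂ : ℂ) - (n : ℂ)) / 2)
      (fun h : HA L e dV hdV dW hdW => ((DoubledWeilDetTwist.detChar L e dV hdV hdV0 dW hdW hdW0 α h : ℂˣ) : ℂ) * swSectionTensor L e dV hdV dW hdW eW e' dV' hdV' hdV0 hdW0 hdV'0 sB (piSchwartzBruhatEquiv (Fp L) (Fin (n' + n')) (a ⊗ₜ[ℂ] f)) h) := by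
    have h1 := hstd.1.1 (((M₂ : ℂ) - (n : ℂ)) / 2)
    rw [hχ] at h1
    simpa only [stdExtension_self] using h1
  have hKf : IsKFinite 𝒦 (fun h : HA L e dV hdV dW hdW => ((DoubledWeilDetTwist.detChar L e dV hdV hdV0 dW hdW hdW0 α h : ℂˣ) : ℂ) * swSectionTensor L e dV hdV dW hdW eW e' dV' hdV' hdV0 hdW0 hdV'0 sB (piSchwartzBruhatEquiv (Fp L) (Fin (n' + n')) (a ⊗ₜ[ℂ] f)) h) := by
    simpa only [stdExtension_self] using hstd.2.1 (((M₂ : ℂ) - (n : ℂ)) / 2)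
  have hcont : Continuous (fun h : HA L e dV hdV dW hdW => ((DoubledWeilDetTwist.detChar L e dV hdV hdV0 dW hdW hdW0 α h : ℂˣ) : ℂ) * swSectionTensor L e dV hdV dW hdW eW e' dV' hdV' hdV0 hdW0 hdV'0 sB (piSchwartzBruhatEquiv (Fp L) (Fin (n' + n')) (a ⊗ₜ[ℂ] f)) h) := by
    simpa only [stdExtension_self] using
      continuous_swTensorTwisted L e dV hdV hdV0 dW hdW hdW0 eW e' dV' hdV' hdV'0 α hM₂ hsB 𝒦 _ hΦ hα (((M₂ : ℂ) - (n : ℂ)) / 2)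
  -- (dec): F2a's split × multiplicativity of `α ∘ det` across `h = (h_∞,1)(1,h_f)`
  have hdec : ∃ (P : UnitaryGroup.finAdelic (Fp L) L (IsCMField.complexConj L) (n + n) (hermD L e dV hdV dW hdW) → ℂ) (Q : UnitaryGroup.arch (Fp L) L (IsCMField.complexConj L) (n + n) (hermD L e dV hdV dW hdW) → ℂ), ∀ h : HA L e dV hdV dW hdW,
      ((DoubledWeilDetTwist.detChar L e dV hdV hdV0 dW hdW hdW0 α h : ℂˣ) : ℂ) * swSectionTensor L e dV hdV dW hdW eW e' dV' hdV' hdV0 hdW0 hdV'0 sB (piSchwartzBruhatEquiv (Fp L) (Fin (n' + n')) (a ⊗ₜ[ℂ] f)) h = P (UnitaryGroup.finPart (Fp L) L (IsCMField.complexConj L) (n + n) (hermD L e dV hdV dW hdW) h) * Q (UnitaryGroup.archPart (Fp L) L (IsCMField.complexConj L) (n + n) (hermD L e dV hdV dW hdW) h) := by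
    obtain ⟨Finf, Ffin, hF⟩ := exists_swSectionTensor_tmul_eq_mul L e dV hdV hdV0 dW hdW hdW0 eW e' dV' hdV' hdV'0 hχbu hχbs hsB
    refine ⟨fun u => ((DoubledWeilDetTwist.detChar L e dV hdV hdV0 dW hdW hdW0 α (UnitaryGroup.finAdelicToAdelic (Fp L) L (IsCMField.complexConj L) (n + n) (hermD L e dV hdV dW hdW) u) : ℂˣ) : ℂ) * Ffin u f, fun x => ((DoubledWeilDetTwist.detChar L e dV hdV hdV0 dW hdW hdW0 α (UnitaryGroup.archToAdelic (Fp L) L (IsCMField.complexConj L) (n + n) (hermD L e dV hdV dW hdW) x) : ℂˣ) : ℂ) * Finf x a, fun h => ?_⟩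
    have hh : (UnitaryGroup.archToAdelic (Fp L) L (IsCMField.complexConj L) (n + n) (hermD L e dV hdV dW hdW) (UnitaryGroup.archPart (Fp L) L (IsCMField.complexConj L) (n + n) (hermD L e dV hdV dW hdW) h) : HA L e dV hdV dW hdW) * (UnitaryGroup.finAdelicToAdelic (Fp L) L (IsCMField.complexConj L) (n + n) (hermD L e dV hdV dW hdW) (UnitaryGroup.finPart (Fp L) L (IsCMField.complexConj L) (n + n) (hermD L e dV hdV dW hdW) h) : HA L e dV hdV dW hdW) = h :=
      UnitaryGroup.archToAdelic_mul_finAdelicToAdelic (Fp L) L (IsCMField.complexConj L) (n + n) (hermD L e dV hdV dW hdW) h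
    have hd : ((DoubledWeilDetTwist.detChar L e dV hdV hdV0 dW hdW hdW0 α h : ℂˣ) : ℂ) = ((DoubledWeilDetTwist.detChar L e dV hdV hdV0 dW hdW hdW0 α (UnitaryGroup.archToAdelic (Fp L) L (IsCMField.complexConj L) (n + n) (hermD L e dV hdV dW hdW) (UnitaryGroup.archPart (Fp L) L (IsCMField.complexConj L) (n + n) (hermD L e dV hdV dW hdW) h)) : ℂˣ) : ℂ) * ((DoubledWeilDetTwist.detChar L e dV hdV hdV0 dW hdW hdW0 α (UnitaryGroup.finAdelicToAdelic (Fp L) L (IsCMField.complexConj L) (n + n) (hermD L e dV hdV dW hdW) (UnitaryGroup.finPart (Fp L) L (IsCMField.complexConj L) (n + n) (hermD L e dV hdV dW hdW) h)) : ℂˣ) : ℂ) := by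
      rw [← Units.val_mul, ← map_mul]
      exact congrArg (fun z : HA L e dV hdV dW hdW => ((DoubledWeilDetTwist.detChar L e dV hdV hdV0 dW hdW hdW0 α z : ℂˣ) : ℂ)) hh.symm
    rw [hF, hd]
    ring
  exact exists_archDatum_of_pure L e dV hdV dW hdW 𝒦 χ _ hdec hsec hKf hcont h₀ hφ₀

end Summit.HodgeConjecture.HodgeConjecture.Cruxes.HLiu418.K2LiuTwistedSWPureTensorArchDatum

end
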